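import Summits.CriticalPhenomena.PercolationContinuityZ3.Theorems.Transplant.KNLevelsTargetLemma
import Literature.Probability.Percolation.KozmaNitzanHGluing
import HarnessLib

/-!
# F7 (generic), part 2 — the TARGET PROPERTY over levels and its derivation from H-gluing / Conjecture 3
# (generalises the last section of `L/KozmaNitzanHGluing.lean`, `KozmaNitzan.TargetProperty d p`, from `zdGraph d` to the levels of any graph)

builds on p205010 (kernel theorem, internal audit signed; external expert review pending) — nothing in this file uses p205010 (the
UNCONDITIONAL form via `CSH.kozmaNitzan_conjecture3_holds` is p2-g2's `KNLevels.targetLemma_of_kits_KN`, `KNLevelsTargetLemmaKN.lean`).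
Lane `prim-bschramm`, seat `prim-bschramm-stmt` (task F7, lead 07:32Z; assembly header = p2-g2's `KNLevels.targetLemma_of_kits`, p211887).

READING OF THE ORIGINAL (`L/KozmaNitzanHGluing.lean`, 370 lines): `HGluing ε δ`, `hGluing_of_conjecture3`, the transfers `HGluing.fintype /
.finSupp / .avoiding` and `restrW_compl_singleton_wireW` are ALREADY stated over an arbitrary (countable) vertex type — imported, not re-typed.
The only `ℤ^d`-specific content is the packaging of Lemma 10's conclusion as `TargetProperty d p` and its two derivations; re-typed here:

* `KNLevels.AvoidingGluing V` — the avoiding gluing schema at every `ε` on the vertex type `V` (the `hC` of `targetLemma_of_kits`), with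
  `avoidingGluing_of_hGluing` (`HGluing.avoiding`, `V : Type`) and `avoidingGluing_of_conjecture3` (`hGluing_of_conjecture3`);
* **`KNLevels.TargetProperty G Δ p`** — the conclusion of the generic target lemma as a property of `(G, Δ, p)`: for every `ε > 0` a `δ ∈ (0,1]`
  such that for every level datum satisfying `LHyp`, every nonempty target `T ⊆ D`, every window of levels `[j₀, j₁]` long enough for Step II
  and equipped with Step-III/IV kits at accuracy `δ`, `P_W(o ↔ B) > 1 - δ ⟹ P_W(o ↔ T) > 1 - ε` — the interface between Lemma 10 and Lemmas 11–12 /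
  the scheme in the levels re-typing (as `KozmaNitzan.TargetProperty` is threaded through `KozmaNitzanCorridor/Theorem6`);
* `targetProperty_of_avoidingGluing`, **`targetProperty_of_hGluing`**, **`targetProperty_of_conjecture3`** (all `p < 1`, degree bound `Δ`).
[cite: KozmaNitzan2024, §4 Lemma 10 (p. 17); Conjecture 3 (p. 15); Question 9 (p. 36, the graph H)]
-/

noncomputable section

open MeasureTheory ProbabilityTheory

namespace Summit.CriticalPhenomena.PercolationContinuityZ3.Theorems

namespace Transplant

namespace KNLevels

open Literature.Probability.Percolation Literature.Probability.LatticeModels SimpleGraph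

/-! ## The avoiding gluing schema on a vertex type -/

/-- **The avoiding gluing schema on `V`** (the hypothesis `hC` of `targetLemma_of_kits`): for every `ε > 0` a `δ > 0` such that, for finitely
supported weights, a source `o`, relays `A` with `P(o ↔ A) > 1 - δ`, each joined to the target set `T` inside a region `Rg ∌ o` with probability
`> 1 - δ`, we get `P(o ↔ T) > 1 - ε`. [cite: KozmaNitzan2024, Conjecture 3 (p. 15); §4 p. 22] -/
def AvoidingGluing (V : Type*) : Prop :=
  ∀ ε : ℝ, 0 < ε → ∃ δ : ℝ, 0 < δ ∧ ∀ (w : Sym2 V → unitInterval) (Sf : Finset V),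
    (∀ e : Sym2 V, (∃ x ∈ e, x ∉ Sf) → w e = 0) →
    ∀ (A T : Finset V) (o : V) (Rg : Set V),
      A ⊆ Sf → T ⊆ Sf → o ∈ Sf → T.Nonempty → o ∉ Rg →
      1 - δ < (prodBernoulli w).real (⋃ a ∈ A, openConn o a) →
        (∀ a ∈ A, 1 - δ < (prodBernoulli w).real (⋃ t ∈ T, openConnIn Rg a t)) →
          1 - ε < (prodBernoulli w).real (⋃ t ∈ T, openConn o t)

/-- **H-gluing (at every `ε`) gives the avoiding schema** on every countable vertex type (`HGluing.avoiding`).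
[cite: KozmaNitzan2024, Question 9 (p. 36); Conjecture 3 (p. 15)] -/
theorem avoidingGluing_of_hGluing {V : Type} [Countable V] (hH : ∀ ε : ℝ, 0 < ε → ∃ δ : ℝ, 0 < δ ∧ KozmaNitzan.HGluing ε δ) :
    AvoidingGluing V := by
  intro ε hε
  obtain ⟨δ, hδ, h⟩ := KozmaNitzan.HGluing.avoiding hH hε
  exact ⟨δ, hδ, fun w Sf hw A T o Rg hA hT ho hne hoRg hoA haT => h V w Sf hw A T o Rg hA hT ho hne hoRg hoA haT⟩

/-- **Conjecture 3 gives the avoiding schema** (Conjecture 3 ⇒ Conjecture 3H ⇒ avoiding). [cite: KozmaNitzan2024, Conjecture 3 (p. 15)] -/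
theorem avoidingGluing_of_conjecture3 {V : Type} [Countable V] (hC : KozmaNitzan2024_conjecture3) : AvoidingGluing V :=
  avoidingGluing_of_hGluing fun _ hε => KozmaNitzan.hGluing_of_conjecture3 hC hε

/-! ## The target property over levels -/

variable {V : Type*} [DecidableEq V]

/-- **The target property at `(G, Δ, p)`** — the conclusion of the generic Lemma 10 (`targetLemma_of_kits`) as a property of the parameter:
for every `ε > 0` there is `δ ∈ (0, 1]` such that for every level datum `L` with `LHyp L W p D R`, every nonempty target `T ⊆ D`, every window of
levels `[j₀, j₁] ⊆ [0, R]` with `(1-p)^{-ΔN} ≤ δ · #[j₀, j₁]` carrying at each level a Step-III seed kit and Step-IV face estimates at accuracy `δ`,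
`1 - δ < P_W(o ↔ B⟨0⟩)` implies `1 - ε < P_W(o ↔ T)`.  Generalises `KozmaNitzan.TargetProperty d p`; the interface through which the levels
versions of Lemmas 11–12 and of the exploration scheme consume Lemma 10. [cite: KozmaNitzan2024, §4 Lemma 10 (p. 17)] -/
def TargetProperty (G : SimpleGraph V) [G.LocallyFinite] (Δ : ℕ) (p : unitInterval) : Prop :=
  ∀ ⦃ε : ℝ⦄, 0 < ε → ∃ δ : ℝ, 0 < δ ∧ δ ≤ 1 ∧ ∀ (L : LData G) (W : Sym2 V → unitInterval) (D T : Finset V) (R N j₀ j₁ : ℕ),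
    LHyp L W p D R → j₁ ≤ R → T ⊆ D → T.Nonempty →
    1 / (1 - (p : ℝ)) ^ (Δ * N) ≤ δ * ((Finset.Icc j₀ j₁).card : ℝ) →
    (∀ j ∈ Finset.Icc j₀ j₁, ∃ (σ : SData V) (S : Finset V), SHyp L j σ ∧ σ.N ≤ N ∧
      (1 - (p : ℝ) ^ σ.sB) ^ σ.k ≤ δ ∧ S ⊆ L.X j ∧ S ⊆ D ∧
      (∀ x ∈ σ.K, ∀ e ∈ σ.seed x, e ∉ wireSet (↑S : Set V)) ∧ (∀ x ∈ σ.K, σ.face x ⊆ S) ∧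
      (∀ x ∈ σ.K, 1 - 3 * δ ≤ (prodBernoulli W).real {ω | ∃ u ∈ σ.face x,
        1 - δ < (prodBernoulli (pinW W (wireSet (↑S : Set V)) ω)).real (⋃ t ∈ T, openConnIn (↑D : Set V) u t)})) →
    1 - δ < (prodBernoulli W).real L.reachB →
      1 - ε < (prodBernoulli W).real (⋃ t ∈ T, openConn L.o t)

/-- **The target property from the avoiding gluing schema** (`targetLemma_of_kits`), for every `p < 1` and degree bound `Δ`.
[cite: KozmaNitzan2024, §4 Lemma 10 (pp. 17–22)] -/
theorem targetProperty_of_avoidingGluing [Countable V] {G : SimpleGraph V} [G.LocallyFinite] {Δ : ℕ} (hΔ : ∀ x, G.degree x ≤ Δ)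
    (hC : AvoidingGluing V) (p : unitInterval) (hp1 : (p : ℝ) < 1) : TargetProperty G Δ p :=
  fun _ hε => targetLemma_of_kits hΔ hC p hp1 hε

/-- **The target property from H-gluing** ("Conjecture 3H at every ε"; generalises `KozmaNitzan.targetProperty_of_hGluing`).
[cite: KozmaNitzan2024, §4 Lemma 10 (pp. 17–22); Question 9 (p. 36)] -/
theorem targetProperty_of_hGluing {V : Type} [DecidableEq V] [Countable V] {G : SimpleGraph V} [G.LocallyFinite] {Δ : ℕ}
    (hΔ : ∀ x, G.degree x ≤ Δ) (hH : ∀ ε : ℝ, 0 < ε → ∃ δ : ℝ, 0 < δ ∧ KozmaNitzan.HGluing ε δ) (p : unitInterval) (hp1 : (p : ℝ) < 1) :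
    TargetProperty G Δ p :=
  targetProperty_of_avoidingGluing hΔ (avoidingGluing_of_hGluing hH) p hp1

/-- **The target property from Kozma–Nitzan's Conjecture 3** (generalises `KozmaNitzan.targetProperty_of_conjecture3`; note that on a general
graph no `θ > 0` hypothesis is needed at this stage — it enters only through the kits). [cite: KozmaNitzan2024, §4 Lemma 10 (pp. 17–22); Conjecture 3 (p. 15)] -/
theorem targetProperty_of_conjecture3 {V : Type} [DecidableEq V] [Countable V] {G : SimpleGraph V} [G.LocallyFinite] {Δ : ℕ}
    (hΔ : ∀ x, G.degree x ≤ Δ) (hC : KozmaNitzan2024_conjecture3) (p : unitInterval) (hp1 : (p : ℝ) < 1) : TargetProperty G Δ p :=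
  targetProperty_of_avoidingGluing hΔ (avoidingGluing_of_conjecture3 hC) p hp1

/-- Unpacking: the target property IS the conclusion of `targetLemma_of_kits` at every `ε` (definitional). [folklore] -/
theorem TargetProperty.apply {G : SimpleGraph V} [G.LocallyFinite] {Δ : ℕ} {p : unitInterval} (h : TargetProperty G Δ p)
    {ε : ℝ} (hε : 0 < ε) :
    ∃ δ : ℝ, 0 < δ ∧ δ ≤ 1 ∧ ∀ (L : LData G) (W : Sym2 V → unitInterval) (D T : Finset V) (R N j₀ j₁ : ℕ),
      LHyp L W p D R → j₁ ≤ R → T ⊆ D → T.Nonempty →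
      1 / (1 - (p : ℝ)) ^ (Δ * N) ≤ δ * ((Finset.Icc j₀ j₁).card : ℝ) →
      (∀ j ∈ Finset.Icc j₀ j₁, ∃ (σ : SData V) (S : Finset V), SHyp L j σ ∧ σ.N ≤ N ∧
        (1 - (p : ℝ) ^ σ.sB) ^ σ.k ≤ δ ∧ S ⊆ L.X j ∧ S ⊆ D ∧
        (∀ x ∈ σ.K, ∀ e ∈ σ.seed x, e ∉ wireSet (↑S : Set V)) ∧ (∀ x ∈ σ.K, σ.face x ⊆ S) ∧
        (∀ x ∈ σ.K, 1 - 3 * δ ≤ (prodBernoulli W).real {ω | ∃ u ∈ σ.face x,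
          1 - δ < (prodBernoulli (pinW W (wireSet (↑S : Set V)) ω)).real (⋃ t ∈ T, openConnIn (↑D : Set V) u t)})) →
      1 - δ < (prodBernoulli W).real L.reachB →
        1 - ε < (prodBernoulli W).real (⋃ t ∈ T, openConn L.o t) :=
  h hε

end KNLevels

end Transplant

end Summit.CriticalPhenomena.PercolationContinuityZ3.Theorems
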